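import Summits.Ventures.HSemireg.WedgeHankelRecurrenceCompanionAlgebra

/-!
# Venture HSemireg — THE GENERALISED CASSINI IDENTITY: along the shifts of a rational class `q = a/m` (`m` monic of degree `t + 1`) the Hankel determinants of size `t + 1` form a GEOMETRIC
# PROGRESSION, **`det H_t(n ↦ q_{n+k}) = ((−1)^{t+1} m(0))^k · det H_t(q)`** (Fibonacci, `m = X² − X − 1`, `t = 1`: Cassini's `F_k F_{k+2} − F_{k+1}² = −(−1)^k`); the same for every sequence with
# `⟪m, q⟫_s = 0` at all shifts; vanishing from the first shift on when `m(0) = 0`; and **`rank H_t(q∘(·+k)) = rank H_t(q)` when `m(0) ≠ 0`**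

HONEST FRAMING. Part of the Lean index of the computation cell `pub-hsemireg` (seat p10 gen 37, Sunday typer «UNIFORM-IN-n»).
LINEAR ALGEBRA OF HANKEL MATRICES OVER A FIELD ONLY (`Matrix.det ∕ rank`; the lineage's `dualSeq`, `mulResidueMat`, `charSeq`, `hkFun`): no variety, no cohomology theory, no sheaf, no Ext group and no
semiregularity map is constructed here; nothing here says that HC / HC_CM / HC_AV holds; no Literature fact (unproved `Prop`) is declared or used.  Custodian versions as in `WedgeHankelSiegelIdeal` (1/3).
SOURCE OF THE STATEMENT: folklore («Cassini ∕ Catalan-type identities for linear recurrent sequences»: the Hankel determinant of order = the order of the recurrence is multiplied by `± m(0)` under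
the shift, because the shift acts on `K[X]/(m)` by the companion matrix of determinant `(−1)^{deg m} m(0)`); here it is read off Barnett's factorisation `H_t(b/m) = H_t(charSeq m) · M_b` (N73)
with `b = X^k a` (N32 `dualSeq_X_pow_mul`) and `det M_X = (−1)^{t+1} m(0)` (N82).  I cite no printed locus for the general-field statement and claim none.
presearch: «Cassini identity linear recurrence Hankel determinant shift» → [tree] `Literature/NumberTheory/ContinuedFractions/FibonacciLucasNumbers.lean` (Cassini for `F_n` only), lineage N82
`det_hankelSq_charSeq_succ` (ONE shift of the impulse-response class `charSeq`); corpus ∕ galaxy needles of N177 (Hankel determinants) gave nothing on shifts; no general statement in the tree.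
DEDUP DISCLOSURE (`rg` of the whole tree + Mathlib, 2026-09-02): `m.coeff 0 ^ k`-type determinant laws do not occur in `WedgeHankelRecurrence*`; N82 has the `k = 1`, `a = 1` case only; the rank
statement along shifts is new (N97 ∕ N142 give ranks of UNshifted classes).  10 names: 0 hits tree-wide.

WHAT IS IN THE TREE.  N32 `Dual`: `dualSeq`, **`dualSeq_X_pow_mul`** (`dualSeq m (X^t a) j = dualSeq m a (j + t)`), `hkFun_dualSeq`, `exists_dualSeq_eq_on_lt`; N23 `Synthesis`: **`eq_of_monic_recurrence`**;
N73 `HankelDeterminant`: **`hankelSq_dualSeq_eq_mul`** (`H_t(a/m) = H_t(charSeq m) · M_a`), **`det_hankelSq_dualSeq`**, `det_hankelSq_charSeq`; N82 `Companion`: **`det_mulResidueMat_X`**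
(`= (−1)^{t+1} m(0)`); N91 `CompanionAlgebra`: **`mulResidueMat_mul`**, **`mulResidueMat_X_pow`**.  Mathlib: `Matrix.det_pow`, `Matrix.rank_mul_eq_right_of_isUnit_det`.
THIS FILE (namespace `Summit.Ventures.HSemireg.Wedge.HankelOuter` continued; PLAIN over N91 `CompanionAlgebra` (whose closure holds N23 ∕ N32 ∕ N73 ∕ N82); 0 definitions):
* §834 `hankelSq_dualSeq_shift`, `det_mulResidueMat_X_pow_mul` (`det M_{X^k a} = ((−1)^{t+1} m(0))^k det M_a`).
* §835 **`det_hankelSq_dualSeq_shift`** (the identity), `det_hankelSq_dualSeq_succ`, `det_hankelSq_dualSeq_shift_eq_zero` (`m(0) = 0`, `k ≥ 1`).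
* §836 `exists_eq_dualSeq_of_forall_hkFun_eq_zero` (global recurrence ⇒ global class), **`det_hankelSq_shift_of_forall_hkFun_eq_zero`**, `det_hankelSq_shift_add_of_forall_hkFun_eq_zero`,
  **`rank_hankelSq_dualSeq_shift`** (`m(0) ≠ 0`), `rank_hankelSq_shift_of_forall_hkFun_eq_zero`.
CAVEATS.  The size is exactly `deg m = t + 1` (for larger sizes both sides vanish by N97 ∕ N172; for smaller sizes there is no such law).  `m` monic (the lineage's `dualSeq`).  Nothing Ext-side.
New names only.
-/

open Polynomial

namespace Summit.Ventures.HSemireg.Wedge.HankelOuter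

open Summit.Ventures.HSemireg.Wedge Summit.Ventures.HSemireg.Wedge.Hankel

section Cassini

variable {K : Type*} [Field K]

/-! ## §834. Shifting a rational class multiplies the numerator by `X^k`: `H_t(q ∘ (·+k)) = H_t(dualSeq m (X^k a))` -/

/-- `H_t(n ↦ (a/m)_{n+k}) = H_t(X^k a / m)` (N32 `dualSeq_X_pow_mul`). [this file, §834] -/
theorem hankelSq_dualSeq_shift (t : ℕ) (m a : K[X]) (k : ℕ) :
    hankelSq K t (fun n => dualSeq K m a (n + k)) = hankelSq K t (dualSeq K m (Polynomial.X ^ k * a)) := by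
  congr 1; funext n; rw [dualSeq_X_pow_mul]

/-- `M_{X^k a} = M_X^k · M_a` and hence `det M_{X^k a} = ((−1)^{t+1} m(0))^k · det M_a` (N91 `mulResidueMat_mul ∕ _X_pow`, N82 `det_mulResidueMat_X`). [this file, §834] -/
theorem det_mulResidueMat_X_pow_mul {t : ℕ} {m : K[X]} (hm : m.Monic) (hmd : m.natDegree = t + 1) (a : K[X]) (k : ℕ) :
    (mulResidueMat K t m (Polynomial.X ^ k * a)).det = ((-1) ^ (t + 1) * m.coeff 0) ^ k * (mulResidueMat K t m a).det := by
  rw [mulResidueMat_mul K hm hmd, Matrix.det_mul, mulResidueMat_X_pow K hm hmd, Matrix.det_pow, det_mulResidueMat_X K hm hmd]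

/-! ## §835. THE GENERALISED CASSINI IDENTITY: along the shifts of a rational class with denominator `m` of degree `t + 1`, the Hankel determinants of size `t + 1` form a GEOMETRIC PROGRESSION
with ratio `(−1)^{t+1} m(0)` -/

/-- **GENERALISED CASSINI: `det H_t(n ↦ q_{n+k}) = ((−1)^{t+1} m(0))^k · det H_t(q)` for `q = dualSeq m a`, `m` monic of degree `t + 1`** (Barnett's factorisation `H_t(b/m) = H_t(charSeq m) · M_b`, N73,
with `b = X^k a` and `det M_X = (−1)^{t+1} m(0)`; for `m = X² − X − 1`, `q = F` the Fibonacci numbers, `t = 1`: Cassini's `F_k F_{k+2} − F_{k+1}² = (−1)^k (F_0 F_2 − F_1²) = −(−1)^k`).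
[this file, §835] -/
theorem det_hankelSq_dualSeq_shift {t : ℕ} {m : K[X]} (hm : m.Monic) (hmd : m.natDegree = t + 1) (a : K[X]) (k : ℕ) :
    (hankelSq K t (fun n => dualSeq K m a (n + k))).det = ((-1) ^ (t + 1) * m.coeff 0) ^ k * (hankelSq K t (dualSeq K m a)).det := by
  rw [hankelSq_dualSeq_shift, det_hankelSq_dualSeq K hm hmd, det_hankelSq_dualSeq K hm hmd, det_mulResidueMat_X_pow_mul hm hmd, mul_left_comm]

/-- One step: `det H_t(q ∘ (·+1)) = (−1)^{t+1} m(0) · det H_t(q)`. [this file, §835] -/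
theorem det_hankelSq_dualSeq_succ {t : ℕ} {m : K[X]} (hm : m.Monic) (hmd : m.natDegree = t + 1) (a : K[X]) :
    (hankelSq K t (fun n => dualSeq K m a (n + 1))).det = (-1) ^ (t + 1) * m.coeff 0 * (hankelSq K t (dualSeq K m a)).det := by
  rw [det_hankelSq_dualSeq_shift hm hmd a 1, pow_one]

/-- **If `m(0) = 0` (the class is not purely periodic ∕ `X ∣ m`) every shifted determinant of size `deg m` vanishes from the first shift on.** [this file, §835] -/
theorem det_hankelSq_dualSeq_shift_eq_zero {t : ℕ} {m : K[X]} (hm : m.Monic) (hmd : m.natDegree = t + 1) (h0 : m.coeff 0 = 0) (a : K[X]) {k : ℕ} (hk : 0 < k) :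
    (hankelSq K t (fun n => dualSeq K m a (n + k))).det = 0 := by
  rw [det_hankelSq_dualSeq_shift hm hmd, h0, mul_zero, zero_pow (Nat.pos_iff_ne_zero.1 hk), zero_mul]

/-! ## §836. The same for any sequence obeying the monic recurrence `m` at every shift (it IS a class `a/m`, N32 ∕ N23), and the RANK along the shifts -/

/-- A sequence obeying the monic recurrence `m` at every shift is globally a dual class `a/m` with `deg a < deg m` (N32 `exists_dualSeq_eq_on_lt` + N23 `eq_of_monic_recurrence`, unique continuation).
[this file, §836] -/
theorem exists_eq_dualSeq_of_forall_hkFun_eq_zero {m : K[X]} (hm : m.Monic) {q : ℕ → K} (h : ∀ s, hkFun K q s m = 0) :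
    ∃ a : K[X], a ∈ Polynomial.degreeLT K m.natDegree ∧ q = dualSeq K m a := by
  obtain ⟨a, ha, hx⟩ := exists_dualSeq_eq_on_lt K hm (fun j => q j)
  refine ⟨a, ha, funext fun j => ?_⟩
  have hrec : ∀ s, hkFun K (dualSeq K m a) s m = 0 := fun s => by
    rw [hkFun_dualSeq, (Polynomial.modByMonic_eq_zero_iff_dvd hm).2 (dvd_mul_of_dvd_right (dvd_mul_right m a) _)]; exact Polynomial.coeff_zero _
  exact eq_of_monic_recurrence K (N := j) hm rfl (fun s _ => h s) (fun s _ => hrec s) (fun i hi => (hx ⟨i, hi⟩).symm) j le_rfl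

/-- **GENERALISED CASSINI, sequence form: if `⟪m, q⟫_s = 0` for all `s` (`m` monic of degree `t + 1`), then `det H_t(q ∘ (·+k)) = ((−1)^{t+1} m(0))^k · det H_t(q)` for every `k`.** [this file, §836] -/
theorem det_hankelSq_shift_of_forall_hkFun_eq_zero {t : ℕ} {m : K[X]} (hm : m.Monic) (hmd : m.natDegree = t + 1) {q : ℕ → K} (h : ∀ s, hkFun K q s m = 0) (k : ℕ) :
    (hankelSq K t (fun n => q (n + k))).det = ((-1) ^ (t + 1) * m.coeff 0) ^ k * (hankelSq K t q).det := by
  obtain ⟨a, -, rfl⟩ := exists_eq_dualSeq_of_forall_hkFun_eq_zero hm h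
  exact det_hankelSq_dualSeq_shift hm hmd a k

/-- **Between two shifts: `det H_t(q∘(·+k)) · det H_t(q∘(·+l))` … precisely `det H_t(q ∘ (·+(k+l))) = ((−1)^{t+1} m(0))^l · det H_t(q ∘ (·+k))`.** [this file, §836] -/
theorem det_hankelSq_shift_add_of_forall_hkFun_eq_zero {t : ℕ} {m : K[X]} (hm : m.Monic) (hmd : m.natDegree = t + 1) {q : ℕ → K} (h : ∀ s, hkFun K q s m = 0) (k l : ℕ) :
    (hankelSq K t (fun n => q (n + (k + l)))).det = ((-1) ^ (t + 1) * m.coeff 0) ^ l * (hankelSq K t (fun n => q (n + k))).det := by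
  rw [det_hankelSq_shift_of_forall_hkFun_eq_zero hm hmd h, det_hankelSq_shift_of_forall_hkFun_eq_zero hm hmd h, pow_add]; ring

/-- **RANK ALONG THE SHIFTS: if `m(0) ≠ 0`, `rank H_t(q ∘ (·+k)) = rank H_t(q)`** for `q = dualSeq m a`, `deg m = t + 1` (`H_t(X^k a/m) = H_t(charSeq m) · M_X^k · M_a` with the first two factors
invertible). [this file, §836] -/
theorem rank_hankelSq_dualSeq_shift {t : ℕ} {m : K[X]} (hm : m.Monic) (hmd : m.natDegree = t + 1) (h0 : m.coeff 0 ≠ 0) (a : K[X]) (k : ℕ) :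
    (hankelSq K t (fun n => dualSeq K m a (n + k))).rank = (hankelSq K t (dualSeq K m a)).rank := by
  have hc : IsUnit (hankelSq K t (charSeq K m)).det := by
    rw [det_hankelSq_charSeq K hm hmd]
    rcases Int.units_eq_one_or (Equiv.Perm.sign (Fin.revPerm : Equiv.Perm (Fin (t + 1)))) with h | h <;> rw [h] <;> simp
  have hX : IsUnit (mulResidueMat K t m Polynomial.X ^ k).det := by
    rw [Matrix.det_pow, det_mulResidueMat_X K hm hmd]; exact (isUnit_iff_ne_zero.2 (mul_ne_zero (pow_ne_zero _ (neg_ne_zero.2 one_ne_zero)) h0)).pow k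
  rw [hankelSq_dualSeq_shift, hankelSq_dualSeq_eq_mul K hm hmd, hankelSq_dualSeq_eq_mul K hm hmd, mulResidueMat_mul K hm hmd, mulResidueMat_X_pow K hm hmd, ← Matrix.mul_assoc,
    Matrix.rank_mul_eq_right_of_isUnit_det _ _ (by rw [Matrix.det_mul]; exact hc.mul hX), Matrix.rank_mul_eq_right_of_isUnit_det _ _ hc]

/-- Sequence form of the rank statement. [this file, §836] -/
theorem rank_hankelSq_shift_of_forall_hkFun_eq_zero {t : ℕ} {m : K[X]} (hm : m.Monic) (hmd : m.natDegree = t + 1) (h0 : m.coeff 0 ≠ 0) {q : ℕ → K} (h : ∀ s, hkFun K q s m = 0) (k : ℕ) :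
    (hankelSq K t (fun n => q (n + k))).rank = (hankelSq K t q).rank := by
  obtain ⟨a, -, rfl⟩ := exists_eq_dualSeq_of_forall_hkFun_eq_zero hm h
  exact rank_hankelSq_dualSeq_shift hm hmd h0 a k

end Cassini

end Summit.Ventures.HSemireg.Wedge.HankelOuter
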